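import Summits.QuantumFields.YangMills.Theses.GronwallGap
import Literature.RepresentationTheory.CompactGroups.UnitaryTrick
import Summits.QuantumFields.YangMills.Theorems.GronwallGapAnalyticDetourStubExpPosSemidef
import Summits.QuantumFields.YangMills.Theorems.GronwallGapAnalyticDetourStubWilsonSegmentAdm
import Summits.QuantumFields.YangMills.Theorems.GronwallGapAnalyticDetourStubNearHaarAnalytic
import Summits.QuantumFields.YangMills.Theorems.GronwallGapAnalyticDetourExactCut
import Summits.QuantumFields.YangMills.Theorems.GronwallGapAnalyticDetourAxisBridge
import Summits.QuantumFields.YangMills.Theorems.GronwallGapAnalyticDetourPathCalculus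

/-!
# Skeleton v5 (line `registered`) for crux `AnalyticDetour` (stmt-QuantumFields-8801) — cycle 3 header (lead c2)

Cycle 3 (continuation lead `prover-line-stmt-QuantumFields-8801-c2-0`, 2026-08-17) RESHAPES the one open stub of
cycles 1–2 (`stub_anchoredDetour`, provably the whole crux: `stub_cutExact`, p157966) along its last exact seam into
TWO registered stubs, each a NECESSARY condition of the crux (exactness theorems in
`Theorems/GronwallGapAnalyticDetourBypassExact.lean`) and jointly sufficient (composition `anchoredDetour_of_bypass`
below, sorry-free, through the landed path calculus `Theorems/GronwallGapAnalyticDetourPathCalculus.lean`, p173226):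

* `stub_axisRegularOffLocallyFinite` (A — "bulk singularities on the Wilson axis are isolated"): for every compact
  simple `G` and lattice representation `r` there is a set `E ⊂ ℝ`, locally finite on `[0, ∞)`, off which the Wilson
  weight `exp(β Re tr r.ρ)`, `β > 0`, has Gateaux-analytic torus pressure in every continuous class direction (`AnP`).
  OPEN (contains "no non-isolated bulk transition of 4D `SU(2)`/`SU(3)` lattice gauge theory"; `E = ∅` is false for
  some `r` of `SU(2)` modulo van Enter–Shlosman, p172139).
* `stub_localBypass` (B — "no coupling is an unavoidable obstruction inside the RP cone"): around every coupling
  `βc > 0` there is `δ > 0` such that any two REGULAR Wilson points `βm ∈ (βc − δ, βc)`, `βp ∈ (βc, βc + δ)`,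
  `βm > 0`, are joined by an admissible weight path with Gateaux-analytic pressure at every parameter.  OPEN (at a
  first-order point the bypass must leave the axis: positive-type detours around the endpoint of the wall).

`stub_anchoredDetour` is now a THEOREM of A and B: anchor `βa ∈ (0, b) ∖ E`; for `β ∉ E` chain Wilson segments over
the `E`-free stretches (admissible by `stub_wilsonSegmentAdm`, regular by A) with local bypasses (B, its regularity
hypotheses discharged by A) around the finitely many exceptional points between `βa` and `β`
(`chain_of_localBypass`: induction on their number), reversing the chain when `β < βa` (`reach_symm`).
`lean check`: sorries = 2 (A, B), zero elsewhere; `AnalyticDetour_skeleton` concludes the crux BY NAME.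

## Cycle 2 header (lead c1)

Cycle 2 (continuation lead `prover-line-stmt-QuantumFields-8801-c1-0`, 2026-08-17) left the stub structure
UNCHANGED (one open stub, `stub_anchoredDetour`) and BRACKETED it with landed theorems (namespace `Summit.QuantumFields.YangMills.Theorems`;
the first two files are imported above, the tightness file `GronwallGapAnalyticDetourExceptionalSetNecessary.lean` is not,
to keep this skeleton independent of the named fact):
* `stub_cutExact` (p157966): `AnalyticDetour ↔ stub_anchoredDetour` — the cut is exact, the stub IS the crux;
* `stub_anchoredDetourOfAxisAnalytic` (p158064): per `(G, r)`, Wilson-axis Gateaux-analyticity `∀ β > 0` gives the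
  stub with `E = ∅` (crossover case; the conjecture for `SU(2)`, `SU(3)` fundamental);
* `stub_wilsonAxisAnalyticAllFalse`, `stub_analyticDetourFalseWithoutE` (p172139): modulo the named fact
  `Literature.MathematicalPhysics.QuantumLattice.enterShlosman_narrowWell_firstOrderTransition` (van Enter–Shlosman
  2005 Thm 2; Literature file p159010, where the narrow-well action is shown to be Wilson's action of the faithful
  unitary representation `(ℂ² ⊕ ℂ ⊕ ℂ)^{⊗(p+1)}` of `SU(2)`), axis analyticity for ALL `(G, r)` is false and the crux
  with `E = ∅` forced is false: the exceptional set is necessary already for `SU(2)`, so the detour clause is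
  load-bearing.  The open stub remains open mathematics (see `Cruxes/AnalyticDetour/STATUS-cycle2.md`).

## Cycle 1 header (lead `prover-line-stmt-QuantumFields-8801-0`)

Lead: `prover-line-stmt-QuantumFields-8801-0`, 2026-08-17.  Route `route-QuantumFields-GronwallGap`,
sub-problem `YangMills`; crux decl `Summit.QuantumFields.YangMills.Theses.GronwallGap.AnalyticDetour`.

Birth cut (planner, `Lines/birth.lean`): WINDOW ⊕ ANCHORED DETOUR glued by concatenation of admissible
analytic weight paths (`AnalyticDetour_of`, sorry-free).  The lead reshaped the window into
worker-sized stubs; ALL SIX of them have LANDED through the gate (imported below, `--supports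
stmt-QuantumFields-8801`):

* `stub_expPosSemidef` — p147711, `Theorems/GronwallGapAnalyticDetourStubExpPosSemidef.lean`
  (entrywise `exp` of a real PSD matrix is PSD; BCR Cor. 3.1.14 via `IsPosDefKernel.exp`).
* `stub_torusPartitionDictionary` — p148816, `…StubTorusPartitionDictionary.lean` (the crux's
  `withDensity … univ` spelling = the finite torus Haar integral of the plaquette product, positive).
* `stub_torusPressureLimit` — p151014, `…StubTorusPressureLimit.lean`, on top of the NEW Literature
  files `Literature/MathematicalPhysics/QuantumLattice/PlaquetteWeightFreeEnergy{,Limit}.lean`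
  (p149760, p150615: Friedli–Velenik Thm. 3.6 thermodynamic limit of the torus pressure for a
  general continuous positive plaquette weight, all torus sides, general `d`).
* `stub_finiteVolumeKPLog` — p153465, `…StubFiniteVolumeKPLog.lean`, on top of the NEW Literature
  files `Literature/MathematicalPhysics/QuantumFieldTheory/LocalFactorKPLogParam.lean` (p152777) and
  `…/TorusClassDirectionKPLog.lean` (p153036): the finite-volume pressure in a complex class
  direction is holomorphic on the unit disc and bounded uniformly in the volume (Kotecký–Preiss
  logarithm of the plaquette gas on `torusSystem`).
* `stub_wilsonSegmentAdm` — p154591, `…StubWilsonSegmentAdm.lean` (the Wilson segment is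
  admissible: Gram kernel `Re tr(ρ(x)ᴴρ(y))`, `IsPosDefKernel.exp`, unitarity, `|Re tr| ≤ N`).

* `stub_nearHaarAnalytic` — p155711, `…StubNearHaarAnalytic.lean` (v3 statement, instance
  binders): there is `η > 0` such that every continuous positive weight `v` on a compact metrisable
  group with `|log v| ≤ η` has Gateaux-analytic torus pressure in every continuous class direction
  (real-axis limits from `tendsto_torusPressure_of_continuous_pos`, Vitali's theorem on the unit
  disc for the holomorphic extensions of `exists_differentiableOn_torusPressure_classDirection`).

THE ONLY OPEN stub (the only `sorry` of this file):

* `stub_anchoredDetour` — the OPEN CORE (unchanged from birth): off a locally finite `E`, every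
  Wilson point is reached from anchors arbitrarily deep in strong coupling by an admissible path
  with analytic pressure.  Contains analyticity of the 4D Wilson pressure in every class direction
  at all but locally finitely many `β` — open mathematics; no worker.

Composition (sorry-free): `strongCouplingWindow_of` derives `T2Space`/`SecondCountableTopology`
of `G` from the faithful representation `r` (closed embedding into matrices), takes `η` from
`stub_nearHaarAnalytic`, sets `β₁ := η/(N+1)` and uses the Wilson segment (`stub_wilsonSegmentAdm`)
with `|((1-s)βa + sβb) Re tr r.ρ g| ≤ β₁ N ≤ η`; `AnalyticDetour_of` (birth, verbatim) then gives
the crux BY NAME from the window and `stub_anchoredDetour`.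

`lean check`: sorries = 1 (`stub_anchoredDetour`), zero elsewhere; the strong-coupling WINDOW is a theorem.
Namespace `Summit.QuantumFields.YangMills.Cruxes.AnalyticDetour.Birth`.
-/

set_option autoImplicit false

noncomputable section

namespace Summit.QuantumFields.YangMills.Cruxes.AnalyticDetour.Birth

open scoped BigOperators
open Summit.QuantumFields.YangMills.Theses.GronwallGap (AnalyticDetour)

/-! ## § The two open stubs — the ONLY `sorry`s of the file (cycle 3 reshape of `stub_anchoredDetour`) -/

/-- **Stub A `stub_axisRegularOffLocallyFinite` — OPEN.**  For every compact simple `G` and lattice representation `r` there is `E ⊂ ℝ`, locally finite on `[0, ∞)`, such that the Wilson weight `exp(β Re tr r.ρ)` has Gateaux-analytic torus pressure in every continuous class direction (`AnP`) at every `β > 0`, `β ∉ E` ("the Gateaux-singular Wilson couplings are isolated").  A necessary condition of the crux (`s = 1` endpoint of its paths). -/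
theorem stub_axisRegularOffLocallyFinite :
    ∀ (G : Type) [Group G] [TopologicalSpace G] [IsTopologicalGroup G] [CompactSpace G], Literature.MathematicalPhysics.QuantumFieldTheory.IsCompactSimpleLieGroup G → letI : MeasurableSpace G := borel G; haveI : BorelSpace G := ⟨rfl⟩; let Pseq : (G → ℝ) → ℕ → ℝ := fun v L => (((L + 1 : ℕ) : ℝ) ^ 4)⁻¹ * Real.log (((MeasureTheory.Measure.pi fun _ : Literature.MathematicalPhysics.QuantumFieldTheory.Edge 4 (L + 1) => Literature.MathematicalPhysics.QuantumFieldTheory.haarProbability G).withDensity (fun U : Literature.MathematicalPhysics.QuantumFieldTheory.GaugeConfig 4 (L + 1) G => ENNReal.ofReal (Literature.MathematicalPhysics.QuantumLattice.groupHeatKernelWeight (fun _ : ℝ => v) 0 U))) Set.univ).toReal; let AnP : (G → ℝ) → Prop := fun v => ∀ φ : G → ℝ, Continuous φ → (∀ g h : G, φ (h * g * h⁻¹) = φ g) → ∃ p : ℝ → ℝ, (∀ t : ℝ, Filter.Tendsto (fun L : ℕ => Pseq (fun g => v g * Real.exp (t * φ g)) L) Filter.atTop (nhds (p t))) ∧ AnalyticAt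 ℝ p 0; ∀ r : Literature.MathematicalPhysics.QuantumFieldTheory.LatticeRep G, ∃ E : Set ℝ, (∀ b : ℝ, (E ∩ Set.Icc 0 b).Finite) ∧ ∀ β : ℝ, 0 < β → β ∉ E → AnP (fun g => Real.exp (β * (r.ρ g).trace.re)) := by
  sorry

/-- **Stub B `stub_localBypass` — OPEN.**  For every compact simple `G`, lattice representation `r` and coupling `βc > 0` there is `δ > 0` such that for all `βm ∈ (βc - δ, βc)`, `βp ∈ (βc, βc + δ)` with `βm > 0` and BOTH Wilson weights `exp(βm Re tr r.ρ)`, `exp(βp Re tr r.ρ)` Gateaux-regular (`AnP`), there is an admissible weight path with Gateaux-analytic pressure at every parameter from the first to the second ("local bypass": no coupling is an unavoidable obstruction inside the reflection-positive cone).  A necessary condition of the crux (reverse and concatenate two of its paths). -/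
theorem stub_localBypass :
    ∀ (G : Type) [Group G] [TopologicalSpace G] [IsTopologicalGroup G] [CompactSpace G], Literature.MathematicalPhysics.QuantumFieldTheory.IsCompactSimpleLieGroup G → letI : MeasurableSpace G := borel G; haveI : BorelSpace G := ⟨rfl⟩; let Pseq : (G → ℝ) → ℕ → ℝ := fun v L => (((L + 1 : ℕ) : ℝ) ^ 4)⁻¹ * Real.log (((MeasureTheory.Measure.pi fun _ : Literature.MathematicalPhysics.QuantumFieldTheory.Edge 4 (L + 1) => Literature.MathematicalPhysics.QuantumFieldTheory.haarProbability G).withDensity (fun U : Literature.MathematicalPhysics.QuantumFieldTheory.GaugeConfig 4 (L + 1) G => ENNReal.ofReal (Literature.MathematicalPhysics.QuantumLattice.groupHeatKernelWeight (fun _ : ℝ => v) 0 U))) Set.univ).toReal; let AnP : (G → ℝ) → Prop := fun v => ∀ φ : G → ℝ, Continuous φ → (∀ g h : G, φ (h * g * h⁻¹) = φ g) → ∃ p : ℝ → ℝ, (∀ t : ℝ, Filter.Tendsto (fun L : ℕ => Pseq (fun g => v g * Real.exp (t * φ g)) L) Filter.atTop (nhds (p t))) ∧ AnalyticAt ℝ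 p 0; let Adm : (ℝ → G → ℝ) → Prop := fun w => (∀ s ∈ Set.Icc (0 : ℝ) 1, Continuous (w s) ∧ (∀ g : G, 0 < w s g) ∧ (∀ g h : G, w s (h * g * h⁻¹) = w s g) ∧ (∀ g : G, w s g⁻¹ = w s g) ∧ (∀ (n : ℕ) (x : Fin n → G) (c : Fin n → ℂ), 0 ≤ (∑ i, ∑ j, (starRingEnd ℂ) (c i) * c j * ((w s ((x i)⁻¹ * x j) : ℝ) : ℂ)).re)) ∧ ∃ Λ : ℝ, ∀ s ∈ Set.Icc (0 : ℝ) 1, ∀ s' ∈ Set.Icc (0 : ℝ) 1, ∀ g : G, |Real.log (w s g) - Real.log (w s' g)| ≤ Λ * |s - s'|; ∀ r : Literature.MathematicalPhysics.QuantumFieldTheory.LatticeRep G, ∀ βc : ℝ, 0 < βc → ∃ δ : ℝ, 0 < δ ∧ ∀ βm ∈ Set.Ioo (βc - δ) βc, ∀ βp ∈ Set.Ioo βc (βc + δ), 0 < βm → AnP (fun g => Real.exp (βm * (r.ρ g).trace.re)) → AnP (fun g => Real.exp (βp * (r.ρ g).trace.re)) → ∃ w : ℝ → G → ℝ, Adm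 w ∧ (∀ s ∈ Set.Icc (0 : ℝ) 1, AnP (w s)) ∧ w 0 = (fun g => Real.exp (βm * (r.ρ g).trace.re)) ∧ w 1 = (fun g => Real.exp (βp * (r.ρ g).trace.re)) := by
  sorry

/-- **`stub_nearHaarAnalytic`** — LANDED (p155711): Gateaux-analytic pressure near the Haar point.** For a compact metrisable group `G` (Borel σ-algebra) there is `η > 0` such that every continuous positive weight `v` with `|log v| ≤ η` has, in every continuous class direction `φ`, a torus pressure `t ↦ lim_L (L+1)⁻⁴ log Z_{L+1}(v e^{tφ})` defined for all real `t` and real-analytic at `t = 0` (rescale `b := t₀ φ`; Vitali on the unit disc — `Literature.Analysis.Complex.exists_tendstoLocallyUniformlyOn_of_frequently_tendsto` — for the holomorphic bounded extensions of `exists_differentiableOn_torusPressure_classDirection`, with real-axis limits from `tendsto_torusPressure_of_continuous_pos` and the dictionary `stub_torusPartitionDictionary`; restrict the holomorphic limit to `ℝ`). -/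
theorem stub_nearHaarAnalytic :
    ∀ (G : Type) [Group G] [TopologicalSpace G] [IsTopologicalGroup G] [CompactSpace G] [T2Space G] [SecondCountableTopology G] [MeasurableSpace G] [BorelSpace G], ∃ η : ℝ, 0 < η ∧ ∀ v : G → ℝ, Continuous v → (∀ g : G, 0 < v g) → (∀ g : G, |Real.log (v g)| ≤ η) → ∀ φ : G → ℝ, Continuous φ → (∀ g h : G, φ (h * g * h⁻¹) = φ g) → ∃ p : ℝ → ℝ, (∀ t : ℝ, Filter.Tendsto (fun L : ℕ => (((L + 1 : ℕ) : ℝ) ^ 4)⁻¹ * Real.log (((MeasureTheory.Measure.pi fun _ : Literature.MathematicalPhysics.QuantumFieldTheory.Edge 4 (L + 1) => Literature.MathematicalPhysics.QuantumFieldTheory.haarProbability G).withDensity (fun U : Literature.MathematicalPhysics.QuantumFieldTheory.GaugeConfig 4 (L + 1) G => ENNReal.ofReal (Literature.MathematicalPhysics.QuantumLattice.groupHeatKernelWeight (fun _ : ℝ => fun g => v g * Real.exp (t * φ g)) 0 U))) Set.univ).toReal) Filter.atTop (nhds (p t))) ∧ AnalyticAt ℝ p 0 :=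
  Summit.QuantumFields.YangMills.Theorems.stub_nearHaarAnalytic

/-! ## § Landed stubs in the cone of the composition (imported; registered names kept)

The other three landed stubs (`stub_torusPressureLimit`, `stub_torusPartitionDictionary`,
`stub_finiteVolumeKPLog`) are consumed inside the landed `stub_nearHaarAnalytic` and are not
repeated here. -/

/-- **`stub_expPosSemidef`** — LANDED (p147711): entrywise exponential preserves positive semidefiniteness. -/
theorem stub_expPosSemidef :
    ∀ (n : ℕ) (A : Matrix (Fin n) (Fin n) ℝ), A.PosSemidef → (A.map Real.exp).PosSemidef :=
  Summit.QuantumFields.YangMills.Theorems.stub_expPosSemidef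

/-- **`stub_wilsonSegmentAdm`** — LANDED (p154591): the Wilson segment is admissible. -/
theorem stub_wilsonSegmentAdm :
    (∀ (n : ℕ) (A : Matrix (Fin n) (Fin n) ℝ), A.PosSemidef → (A.map Real.exp).PosSemidef) → ∀ (G : Type) [Group G] [TopologicalSpace G] [IsTopologicalGroup G] [CompactSpace G], Literature.MathematicalPhysics.QuantumFieldTheory.IsCompactSimpleLieGroup G → letI : MeasurableSpace G := borel G; haveI : BorelSpace G := ⟨rfl⟩; let Adm : (ℝ → G → ℝ) → Prop := fun w => (∀ s ∈ Set.Icc (0 : ℝ) 1, Continuous (w s) ∧ (∀ g : G, 0 < w s g) ∧ (∀ g h : G, w s (h * g * h⁻¹) = w s g) ∧ (∀ g : G, w s g⁻¹ = w s g) ∧ (∀ (n : ℕ) (x : Fin n → G) (c : Fin n → ℂ), 0 ≤ (∑ i, ∑ j, (starRingEnd ℂ) (c i) * c j * ((w s ((x i)⁻¹ * x j) : ℝ) : ℂ)).re)) ∧ ∃ Λ : ℝ, ∀ s ∈ Set.Icc (0 : ℝ) 1, ∀ s' ∈ Set.Icc (0 : ℝ) 1, ∀ g : G, |Real.log (w s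 g) - Real.log (w s' g)| ≤ Λ * |s - s'|; ∀ (r : Literature.MathematicalPhysics.QuantumFieldTheory.LatticeRep G) (βa βb : ℝ), 0 ≤ βa → 0 ≤ βb → Adm (fun s g => Real.exp (((1 - s) * βa + s * βb) * (r.ρ g).trace.re)) :=
  Summit.QuantumFields.YangMills.Theorems.stub_wilsonSegmentAdm

/-! ## § The window — sorry-free composition -/

/-- **Composition of the window (real proof).**  `T2Space`/`SecondCountableTopology` of `G` from
the closed embedding `r.ρ`; `η` from `stub_nearHaarAnalytic`; `β₁ := η/(N+1)`; for
`βa, βb ∈ (0, β₁)` the witness is the Wilson segment; `Adm` from `stub_wilsonSegmentAdm`, `AnP` at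
every parameter since `|((1-s)βa + sβb) Re tr r.ρ g| ≤ β₁ N ≤ η`; endpoints by `norm_num`. -/
theorem strongCouplingWindow_of :
    ((∀ (n : ℕ) (A : Matrix (Fin n) (Fin n) ℝ), A.PosSemidef → (A.map Real.exp).PosSemidef) → ∀ (G : Type) [Group G] [TopologicalSpace G] [IsTopologicalGroup G] [CompactSpace G], Literature.MathematicalPhysics.QuantumFieldTheory.IsCompactSimpleLieGroup G → letI : MeasurableSpace G := borel G; haveI : BorelSpace G := ⟨rfl⟩; let Adm : (ℝ → G → ℝ) → Prop := fun w => (∀ s ∈ Set.Icc (0 : ℝ) 1, Continuous (w s) ∧ (∀ g : G, 0 < w s g) ∧ (∀ g h : G, w s (h * g * h⁻¹) = w s g) ∧ (∀ g : G, w s g⁻¹ = w s g) ∧ (∀ (n : ℕ) (x : Fin n → G) (c : Fin n → ℂ), 0 ≤ (∑ i, ∑ j, (starRingEnd ℂ) (c i) * c j * ((w s ((x i)⁻¹ * x j) : ℝ) : ℂ)).re)) ∧ ∃ Λ : ℝ, ∀ s ∈ Set.Icc (0 : ℝ) 1, ∀ s' ∈ Set.Icc (0 : ℝ) 1, ∀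 g : G, |Real.log (w s g) - Real.log (w s' g)| ≤ Λ * |s - s'|; ∀ (r : Literature.MathematicalPhysics.QuantumFieldTheory.LatticeRep G) (βa βb : ℝ), 0 ≤ βa → 0 ≤ βb → Adm (fun s g => Real.exp (((1 - s) * βa + s * βb) * (r.ρ g).trace.re))) →
    (∀ (G : Type) [Group G] [TopologicalSpace G] [IsTopologicalGroup G] [CompactSpace G] [T2Space G] [SecondCountableTopology G] [MeasurableSpace G] [BorelSpace G], ∃ η : ℝ, 0 < η ∧ ∀ v : G → ℝ, Continuous v → (∀ g : G, 0 < v g) → (∀ g : G, |Real.log (v g)| ≤ η) → ∀ φ : G → ℝ, Continuous φ → (∀ g h : G, φ (h * g * h⁻¹) = φ g) → ∃ p : ℝ → ℝ, (∀ t : ℝ, Filter.Tendsto (fun L : ℕ => (((L + 1 : ℕ) : ℝ) ^ 4)⁻¹ * Real.log (((MeasureTheory.Measure.pi fun _ : Literature.MathematicalPhysics.QuantumFieldTheory.Edge 4 (L + 1) => Literature.MathematicalPhysics.QuantumFieldTheory.haarProbability G).withDensity (fun U : Literature.MathematicalPhysics.QuantumFieldTheory.GaugeConfig 4 (L + 1)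 G => ENNReal.ofReal (Literature.MathematicalPhysics.QuantumLattice.groupHeatKernelWeight (fun _ : ℝ => fun g => v g * Real.exp (t * φ g)) 0 U))) Set.univ).toReal) Filter.atTop (nhds (p t))) ∧ AnalyticAt ℝ p 0) →
    (∀ (n : ℕ) (A : Matrix (Fin n) (Fin n) ℝ), A.PosSemidef → (A.map Real.exp).PosSemidef) →
    ∀ (G : Type) [Group G] [TopologicalSpace G] [IsTopologicalGroup G] [CompactSpace G], Literature.MathematicalPhysics.QuantumFieldTheory.IsCompactSimpleLieGroup G → letI : MeasurableSpace G := borel G; haveI : BorelSpace G := ⟨rfl⟩; let Pseq : (G → ℝ) → ℕ → ℝ := fun v L => (((L + 1 : ℕ) : ℝ) ^ 4)⁻¹ * Real.log (((MeasureTheory.Measure.pi fun _ : Literature.MathematicalPhysics.QuantumFieldTheory.Edge 4 (L + 1) => Literature.MathematicalPhysics.QuantumFieldTheory.haarProbability G).withDensity (fun U : Literature.MathematicalPhysics.QuantumFieldTheory.GaugeConfig 4 (L + 1) G => ENNReal.ofReal (Literature.MathematicalPhysics.QuantumLattice.groupHeatKernelWeight (fun _ : ℝ => v) 0 U))) Set.univ).toReal;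 let AnP : (G → ℝ) → Prop := fun v => ∀ φ : G → ℝ, Continuous φ → (∀ g h : G, φ (h * g * h⁻¹) = φ g) → ∃ p : ℝ → ℝ, (∀ t : ℝ, Filter.Tendsto (fun L : ℕ => Pseq (fun g => v g * Real.exp (t * φ g)) L) Filter.atTop (nhds (p t))) ∧ AnalyticAt ℝ p 0; let Adm : (ℝ → G → ℝ) → Prop := fun w => (∀ s ∈ Set.Icc (0 : ℝ) 1, Continuous (w s) ∧ (∀ g : G, 0 < w s g) ∧ (∀ g h : G, w s (h * g * h⁻¹) = w s g) ∧ (∀ g : G, w s g⁻¹ = w s g) ∧ (∀ (n : ℕ) (x : Fin n → G) (c : Fin n → ℂ), 0 ≤ (∑ i, ∑ j, (starRingEnd ℂ) (c i) * c j * ((w s ((x i)⁻¹ * x j) : ℝ) : ℂ)).re)) ∧ ∃ Λ : ℝ, ∀ s ∈ Set.Icc (0 : ℝ) 1, ∀ s' ∈ Set.Icc (0 : ℝ) 1, ∀ g : G, |Real.log (w s g) - Real.log (w s' g)| ≤ Λ * |s - s'|; ∀ r : Literature.MathematicalPhysics.QuantumFieldTheory.LatticeRep G, ∃ β₁ : ℝ,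 0 < β₁ ∧ ∀ βa ∈ Set.Ioo (0 : ℝ) β₁, ∀ βb ∈ Set.Ioo (0 : ℝ) β₁, ∃ w : ℝ → G → ℝ, Adm w ∧ (∀ s ∈ Set.Icc (0 : ℝ) 1, AnP (w s)) ∧ w 0 = (fun g => Real.exp (βa * (r.ρ g).trace.re)) ∧ w 1 = (fun g => Real.exp (βb * (r.ρ g).trace.re)) := by
  intro hG1 hG2 h2 G i1 i2 i3 i4 hG Pseq AnP Adm r
  letI : MeasurableSpace G := borel G
  haveI : BorelSpace G := ⟨rfl⟩
  -- `G` is compact metrisable: the faithful representation is a closed embedding into matrices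
  have hemb : Topology.IsClosedEmbedding r.ρ := r.continuous.isClosedEmbedding r.injective
  haveI : T2Space G := hemb.isEmbedding.t2Space
  haveI : SecondCountableTopology (Matrix (Fin r.N) (Fin r.N) ℂ) :=
    inferInstanceAs (SecondCountableTopology (Fin r.N → Fin r.N → ℂ))
  haveI : SecondCountableTopology G := hemb.isEmbedding.secondCountableTopology
  obtain ⟨η, hη, hAn⟩ := hG2 G
  have hAdm := hG1 h2 G hG r
  have hN : ∀ g : G, |(r.ρ g).trace.re| ≤ r.N := fun g => by
    simpa using Literature.RepresentationTheory.CompactGroups.CompactGroup.abs_re_trace_le_card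
      r.ρ r.continuous g
  have hN0 : (0 : ℝ) ≤ r.N := Nat.cast_nonneg _
  set β₁ : ℝ := η / (r.N + 1) with hβ₁
  have hβ₁pos : 0 < β₁ := by positivity
  have hβ₁N : β₁ * r.N ≤ η := by
    rw [hβ₁, div_mul_eq_mul_div, div_le_iff₀ (by positivity)]
    nlinarith
  refine ⟨β₁, hβ₁pos, fun βa hβa βb hβb => ?_⟩
  obtain ⟨hβa0, hβa1⟩ := hβa
  obtain ⟨hβb0, hβb1⟩ := hβb
  have hTc : Continuous fun g : G => (r.ρ g).trace.re :=
    Complex.continuous_re.comp r.continuous.matrix_trace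
  refine ⟨fun s g => Real.exp (((1 - s) * βa + s * βb) * (r.ρ g).trace.re),
    hAdm βa βb hβa0.le hβb0.le, ?_, ?_, ?_⟩
  · intro s hs
    obtain ⟨hs0, hs1⟩ := hs
    refine hAn _ (Real.continuous_exp.comp (continuous_const.mul hTc)) (fun g => Real.exp_pos _)
      fun g => ?_
    rw [Real.log_exp, abs_mul]
    have hc0 : 0 ≤ (1 - s) * βa + s * βb := by nlinarith
    have hc1 : (1 - s) * βa + s * βb ≤ β₁ := by nlinarith
    rw [abs_of_nonneg hc0]
    calc ((1 - s) * βa + s * βb) * |(r.ρ g).trace.re| ≤ β₁ * r.N :=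
          mul_le_mul hc1 (hN g) (abs_nonneg _) hβ₁pos.le
      _ ≤ η := hβ₁N
  · funext g
    norm_num
  · funext g
    norm_num

/-- **The strong-coupling window (birth's `stub_strongCouplingWindow`), now a THEOREM (all six window
stubs landed)**: instantiate `strongCouplingWindow_of` with the stubs BY NAME. -/
theorem strongCouplingWindow :
    ∀ (G : Type) [Group G] [TopologicalSpace G] [IsTopologicalGroup G] [CompactSpace G], Literature.MathematicalPhysics.QuantumFieldTheory.IsCompactSimpleLieGroup G → letI : MeasurableSpace G := borel G; haveI : BorelSpace G := ⟨rfl⟩; let Pseq : (G → ℝ) → ℕ → ℝ := fun v L => (((L + 1 : ℕ) : ℝ) ^ 4)⁻¹ * Real.log (((MeasureTheory.Measure.pi fun _ : Literature.MathematicalPhysics.QuantumFieldTheory.Edge 4 (L + 1) => Literature.MathematicalPhysics.QuantumFieldTheory.haarProbability G).withDensity (fun U : Literature.MathematicalPhysics.QuantumFieldTheory.GaugeConfig 4 (L + 1) G => ENNReal.ofReal (Literature.MathematicalPhysics.QuantumLattice.groupHeatKernelWeight (fun _ : ℝ => v) 0 U))) Set.univ).toReal; let AnP : (G → ℝ) →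 Prop := fun v => ∀ φ : G → ℝ, Continuous φ → (∀ g h : G, φ (h * g * h⁻¹) = φ g) → ∃ p : ℝ → ℝ, (∀ t : ℝ, Filter.Tendsto (fun L : ℕ => Pseq (fun g => v g * Real.exp (t * φ g)) L) Filter.atTop (nhds (p t))) ∧ AnalyticAt ℝ p 0; let Adm : (ℝ → G → ℝ) → Prop := fun w => (∀ s ∈ Set.Icc (0 : ℝ) 1, Continuous (w s) ∧ (∀ g : G, 0 < w s g) ∧ (∀ g h : G, w s (h * g * h⁻¹) = w s g) ∧ (∀ g : G, w s g⁻¹ = w s g) ∧ (∀ (n : ℕ) (x : Fin n → G) (c : Fin n → ℂ), 0 ≤ (∑ i, ∑ j, (starRingEnd ℂ) (c i) * c j * ((w s ((x i)⁻¹ * x j) : ℝ) : ℂ)).re)) ∧ ∃ Λ : ℝ, ∀ s ∈ Set.Icc (0 : ℝ) 1, ∀ s' ∈ Set.Icc (0 : ℝ) 1, ∀ g : G, |Real.log (w s g) - Real.log (w s' g)| ≤ Λ * |s - s'|; ∀ r : Literature.MathematicalPhysics.QuantumFieldTheory.LatticeRep G, ∃ β₁ : ℝ, 0 < β₁ ∧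 ∀ βa ∈ Set.Ioo (0 : ℝ) β₁, ∀ βb ∈ Set.Ioo (0 : ℝ) β₁, ∃ w : ℝ → G → ℝ, Adm w ∧ (∀ s ∈ Set.Icc (0 : ℝ) 1, AnP (w s)) ∧ w 0 = (fun g => Real.exp (βa * (r.ρ g).trace.re)) ∧ w 1 = (fun g => Real.exp (βb * (r.ρ g).trace.re)) :=
  strongCouplingWindow_of stub_wilsonSegmentAdm stub_nearHaarAnalytic stub_expPosSemidef

/-! ## § Glue — concatenation of admissible analytic paths (sorry-free) -/

/-- Concatenation of two weight paths on `[0,1]`: run `w₁` at double speed on `[0,½]`, then `w₂`. -/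
def concat {G : Type} (w₁ w₂ : ℝ → G → ℝ) (s : ℝ) : G → ℝ :=
  if s ≤ 1 / 2 then w₁ (2 * s) else w₂ (2 * s - 1)

theorem concat_zero {G : Type} (w₁ w₂ : ℝ → G → ℝ) : concat w₁ w₂ 0 = w₁ 0 := by
  norm_num [concat]

theorem concat_one {G : Type} (w₁ w₂ : ℝ → G → ℝ) : concat w₁ w₂ 1 = w₂ 1 := by
  norm_num [concat]

/-- Pointwise-in-`s` properties transfer to the concatenation. -/
theorem concat_forall {G : Type} (Q : (G → ℝ) → Prop) {w₁ w₂ : ℝ → G → ℝ}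
    (hQ₁ : ∀ s ∈ Set.Icc (0 : ℝ) 1, Q (w₁ s)) (hQ₂ : ∀ s ∈ Set.Icc (0 : ℝ) 1, Q (w₂ s)) :
    ∀ s ∈ Set.Icc (0 : ℝ) 1, Q (concat w₁ w₂ s) := by
  intro s hs
  obtain ⟨hs0, hs1⟩ := hs
  by_cases h : s ≤ 1 / 2
  · rw [concat, if_pos h]
    exact hQ₁ (2 * s) ⟨by linarith, by linarith⟩
  · rw [concat, if_neg h]
    rw [not_le] at h
    exact hQ₂ (2 * s - 1) ⟨by linarith, by linarith⟩

/-- Log-Lipschitz control of the concatenation, ordered parameters. -/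
theorem concat_log_lipschitz_of_le {G : Type} {w₁ w₂ : ℝ → G → ℝ} {Λ₁ Λ₂ : ℝ}
    (hL₁ : ∀ s ∈ Set.Icc (0 : ℝ) 1, ∀ s' ∈ Set.Icc (0 : ℝ) 1, ∀ g : G,
      |Real.log (w₁ s g) - Real.log (w₁ s' g)| ≤ Λ₁ * |s - s'|)
    (hL₂ : ∀ s ∈ Set.Icc (0 : ℝ) 1, ∀ s' ∈ Set.Icc (0 : ℝ) 1, ∀ g : G,
      |Real.log (w₂ s g) - Real.log (w₂ s' g)| ≤ Λ₂ * |s - s'|)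
    (hjoin : w₁ 1 = w₂ 0) {s s' : ℝ} (hss' : s ≤ s')
    (hs : s ∈ Set.Icc (0 : ℝ) 1) (hs' : s' ∈ Set.Icc (0 : ℝ) 1) (g : G) :
    |Real.log (concat w₁ w₂ s g) - Real.log (concat w₁ w₂ s' g)| ≤
      2 * (|Λ₁| + |Λ₂|) * (s' - s) := by
  obtain ⟨hs0, hs1⟩ := hs
  obtain ⟨hs0', hs1'⟩ := hs'
  have hA₁ : 0 ≤ |Λ₁| := abs_nonneg _
  have hA₂ : 0 ≤ |Λ₂| := abs_nonneg _
  have hΛ₁ : Λ₁ ≤ |Λ₁| := le_abs_self _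
  have hΛ₂ : Λ₂ ≤ |Λ₂| := le_abs_self _
  by_cases h' : s' ≤ 1 / 2
  · -- both parameters in the first half
    have h : s ≤ 1 / 2 := le_trans hss' h'
    simp only [concat, if_pos h, if_pos h']
    have key := hL₁ (2 * s) ⟨by linarith, by linarith⟩ (2 * s') ⟨by linarith, by linarith⟩ g
    have e : |2 * s - 2 * s'| = 2 * (s' - s) := by
      rw [abs_of_nonpos (by linarith)]; ring
    rw [e] at key
    have m : Λ₁ * (2 * (s' - s)) ≤ |Λ₁| * (2 * (s' - s)) :=
      mul_le_mul_of_nonneg_right hΛ₁ (by linarith)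
    have n : 0 ≤ |Λ₂| * (s' - s) := mul_nonneg hA₂ (by linarith)
    linarith
  · rw [not_le] at h'
    by_cases h : s ≤ 1 / 2
    · -- `s` in the first half, `s'` in the second: go through the junction `w₁ 1 = w₂ 0`
      simp only [concat, if_pos h, if_neg (not_le.mpr h')]
      have k1 := hL₁ (2 * s) ⟨by linarith, by linarith⟩ 1 ⟨by norm_num, by norm_num⟩ g
      have k2 := hL₂ 0 ⟨le_rfl, by norm_num⟩ (2 * s' - 1) ⟨by linarith, by linarith⟩ g
      have e1 : |2 * s - 1| = 1 - 2 * s := by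
        rw [abs_of_nonpos (by linarith)]; ring
      have e2 : |(0 : ℝ) - (2 * s' - 1)| = 2 * s' - 1 := by
        rw [abs_of_nonpos (by linarith)]; ring
      rw [e1] at k1
      rw [e2] at k2
      have hj : w₁ 1 g = w₂ 0 g := by rw [hjoin]
      rw [hj] at k1
      have tri := abs_sub_le (Real.log (w₁ (2 * s) g)) (Real.log (w₂ 0 g))
        (Real.log (w₂ (2 * s' - 1) g))
      have m1 : Λ₁ * (1 - 2 * s) ≤ |Λ₁| * (1 - 2 * s) :=
        mul_le_mul_of_nonneg_right hΛ₁ (by linarith)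
      have m2 : Λ₂ * (2 * s' - 1) ≤ |Λ₂| * (2 * s' - 1) :=
        mul_le_mul_of_nonneg_right hΛ₂ (by linarith)
      have n1 : 0 ≤ |Λ₁| * (2 * s' - 1) := mul_nonneg hA₁ (by linarith)
      have n2 : 0 ≤ |Λ₂| * (1 - 2 * s) := mul_nonneg hA₂ (by linarith)
      linarith
    · -- both parameters in the second half
      rw [not_le] at h
      simp only [concat, if_neg (not_le.mpr h), if_neg (not_le.mpr h')]
      have key := hL₂ (2 * s - 1) ⟨by linarith, by linarith⟩ (2 * s' - 1)
        ⟨by linarith, by linarith⟩ g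
      have e : |2 * s - 1 - (2 * s' - 1)| = 2 * (s' - s) := by
        rw [abs_of_nonpos (by linarith)]; ring
      rw [e] at key
      have m : Λ₂ * (2 * (s' - s)) ≤ |Λ₂| * (2 * (s' - s)) :=
        mul_le_mul_of_nonneg_right hΛ₂ (by linarith)
      have n : 0 ≤ |Λ₁| * (s' - s) := mul_nonneg hA₁ (by linarith)
      linarith

/-- Log-Lipschitz control of the concatenation. -/
theorem concat_log_lipschitz {G : Type} {w₁ w₂ : ℝ → G → ℝ} {Λ₁ Λ₂ : ℝ}
    (hL₁ : ∀ s ∈ Set.Icc (0 : ℝ) 1, ∀ s' ∈ Set.Icc (0 : ℝ) 1, ∀ g : G,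
      |Real.log (w₁ s g) - Real.log (w₁ s' g)| ≤ Λ₁ * |s - s'|)
    (hL₂ : ∀ s ∈ Set.Icc (0 : ℝ) 1, ∀ s' ∈ Set.Icc (0 : ℝ) 1, ∀ g : G,
      |Real.log (w₂ s g) - Real.log (w₂ s' g)| ≤ Λ₂ * |s - s'|)
    (hjoin : w₁ 1 = w₂ 0) :
    ∀ s ∈ Set.Icc (0 : ℝ) 1, ∀ s' ∈ Set.Icc (0 : ℝ) 1, ∀ g : G,
      |Real.log (concat w₁ w₂ s g) - Real.log (concat w₁ w₂ s' g)| ≤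
        2 * (|Λ₁| + |Λ₂|) * |s - s'| := by
  intro s hs s' hs' g
  rcases le_total s s' with hle | hle
  · rw [abs_of_nonpos (sub_nonpos.mpr hle), neg_sub]
    exact concat_log_lipschitz_of_le hL₁ hL₂ hjoin hle hs hs' g
  · rw [abs_of_nonneg (sub_nonneg.mpr hle), abs_sub_comm]
    exact concat_log_lipschitz_of_le hL₁ hL₂ hjoin hle hs' hs g

/-! ## § The anchored detour from A and B — sorry-free composition (cycle 3) -/

/-- **Composition (real proof): A ∧ B ⇒ the anchored detour.**  `E` from A; anchor `βa ∈ (0, b) ∖ E` (the interval is infinite, `E ∩ [0, b]` finite); for `β > 0`, `β ∉ E` with `βa ≤ β` apply `chain_of_localBypass` to the relation "Wilson(`a`) is joined to Wilson(`b`) by an admissible path with `AnP` at every parameter": transitive by concatenation (`reach_trans`), true along `E`-free segments `[a, b] ⊂ (0, ∞)` (the Wilson segment: admissible by `stub_wilsonSegmentAdm`, regular at every parameter by A since the running coupling stays in `[a, b]`), with local bypasses from B (regularity of the two endpoints by A); for `β < βa` reverse the chain (`reach_symm`). -/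
theorem anchoredDetour_of_bypass :
    (∀ (G : Type) [Group G] [TopologicalSpace G] [IsTopologicalGroup G] [CompactSpace G], Literature.MathematicalPhysics.QuantumFieldTheory.IsCompactSimpleLieGroup G → letI : MeasurableSpace G := borel G; haveI : BorelSpace G := ⟨rfl⟩; let Pseq : (G → ℝ) → ℕ → ℝ := fun v L => (((L + 1 : ℕ) : ℝ) ^ 4)⁻¹ * Real.log (((MeasureTheory.Measure.pi fun _ : Literature.MathematicalPhysics.QuantumFieldTheory.Edge 4 (L + 1) => Literature.MathematicalPhysics.QuantumFieldTheory.haarProbability G).withDensity (fun U : Literature.MathematicalPhysics.QuantumFieldTheory.GaugeConfig 4 (L + 1) G => ENNReal.ofReal (Literature.MathematicalPhysics.QuantumLattice.groupHeatKernelWeight (fun _ : ℝ => v) 0 U))) Set.univ).toReal; let AnP : (G → ℝ) → Prop := fun v => ∀ φ : G → ℝ, Continuous φ → (∀ g h : G, φ (h * g * h⁻¹) = φ g) → ∃ p : ℝ → ℝ, (∀ t : ℝ, Filter.Tendsto (fun L : ℕ => Pseq (fun g => v g * Real.exp (t * φ g)) L) Filter.atTop (nhds (p t))) ∧ AnalyticAt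 ℝ p 0; ∀ r : Literature.MathematicalPhysics.QuantumFieldTheory.LatticeRep G, ∃ E : Set ℝ, (∀ b : ℝ, (E ∩ Set.Icc 0 b).Finite) ∧ ∀ β : ℝ, 0 < β → β ∉ E → AnP (fun g => Real.exp (β * (r.ρ g).trace.re))) →
    (∀ (G : Type) [Group G] [TopologicalSpace G] [IsTopologicalGroup G] [CompactSpace G], Literature.MathematicalPhysics.QuantumFieldTheory.IsCompactSimpleLieGroup G → letI : MeasurableSpace G := borel G; haveI : BorelSpace G := ⟨rfl⟩; let Pseq : (G → ℝ) → ℕ → ℝ := fun v L => (((L + 1 : ℕ) : ℝ) ^ 4)⁻¹ * Real.log (((MeasureTheory.Measure.pi fun _ : Literature.MathematicalPhysics.QuantumFieldTheory.Edge 4 (L + 1) => Literature.MathematicalPhysics.QuantumFieldTheory.haarProbability G).withDensity (fun U : Literature.MathematicalPhysics.QuantumFieldTheory.GaugeConfig 4 (L + 1) G => ENNReal.ofReal (Literature.MathematicalPhysics.QuantumLattice.groupHeatKernelWeight (fun _ : ℝ => v) 0 U))) Set.univ).toReal; let AnP : (G → ℝ) → Prop := fun v => ∀ φ : G → ℝ,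 Continuous φ → (∀ g h : G, φ (h * g * h⁻¹) = φ g) → ∃ p : ℝ → ℝ, (∀ t : ℝ, Filter.Tendsto (fun L : ℕ => Pseq (fun g => v g * Real.exp (t * φ g)) L) Filter.atTop (nhds (p t))) ∧ AnalyticAt ℝ p 0; let Adm : (ℝ → G → ℝ) → Prop := fun w => (∀ s ∈ Set.Icc (0 : ℝ) 1, Continuous (w s) ∧ (∀ g : G, 0 < w s g) ∧ (∀ g h : G, w s (h * g * h⁻¹) = w s g) ∧ (∀ g : G, w s g⁻¹ = w s g) ∧ (∀ (n : ℕ) (x : Fin n → G) (c : Fin n → ℂ), 0 ≤ (∑ i, ∑ j, (starRingEnd ℂ) (c i) * c j * ((w s ((x i)⁻¹ * x j) : ℝ) : ℂ)).re)) ∧ ∃ Λ : ℝ, ∀ s ∈ Set.Icc (0 : ℝ) 1, ∀ s' ∈ Set.Icc (0 : ℝ) 1, ∀ g : G, |Real.log (w s g) - Real.log (w s' g)| ≤ Λ * |s - s'|; ∀ r : Literature.MathematicalPhysics.QuantumFieldTheory.LatticeRep G, ∀ βc : ℝ, 0 < βc → ∃ δ : ℝ, 0 < δ ∧ ∀ βm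 ∈ Set.Ioo (βc - δ) βc, ∀ βp ∈ Set.Ioo βc (βc + δ), 0 < βm → AnP (fun g => Real.exp (βm * (r.ρ g).trace.re)) → AnP (fun g => Real.exp (βp * (r.ρ g).trace.re)) → ∃ w : ℝ → G → ℝ, Adm w ∧ (∀ s ∈ Set.Icc (0 : ℝ) 1, AnP (w s)) ∧ w 0 = (fun g => Real.exp (βm * (r.ρ g).trace.re)) ∧ w 1 = (fun g => Real.exp (βp * (r.ρ g).trace.re))) →
    ∀ (G : Type) [Group G] [TopologicalSpace G] [IsTopologicalGroup G] [CompactSpace G], Literature.MathematicalPhysics.QuantumFieldTheory.IsCompactSimpleLieGroup G → letI : MeasurableSpace G := borel G; haveI : BorelSpace G := ⟨rfl⟩; let Pseq : (G → ℝ) → ℕ → ℝ := fun v L => (((L + 1 : ℕ) : ℝ) ^ 4)⁻¹ * Real.log (((MeasureTheory.Measure.pi fun _ : Literature.MathematicalPhysics.QuantumFieldTheory.Edge 4 (L + 1) => Literature.MathematicalPhysics.QuantumFieldTheory.haarProbability G).withDensity (fun U : Literature.MathematicalPhysics.QuantumFieldTheory.GaugeConfig 4 (L + 1) G => ENNReal.ofReal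 (Literature.MathematicalPhysics.QuantumLattice.groupHeatKernelWeight (fun _ : ℝ => v) 0 U))) Set.univ).toReal; let AnP : (G → ℝ) → Prop := fun v => ∀ φ : G → ℝ, Continuous φ → (∀ g h : G, φ (h * g * h⁻¹) = φ g) → ∃ p : ℝ → ℝ, (∀ t : ℝ, Filter.Tendsto (fun L : ℕ => Pseq (fun g => v g * Real.exp (t * φ g)) L) Filter.atTop (nhds (p t))) ∧ AnalyticAt ℝ p 0; let Adm : (ℝ → G → ℝ) → Prop := fun w => (∀ s ∈ Set.Icc (0 : ℝ) 1, Continuous (w s) ∧ (∀ g : G, 0 < w s g) ∧ (∀ g h : G, w s (h * g * h⁻¹) = w s g) ∧ (∀ g : G, w s g⁻¹ = w s g) ∧ (∀ (n : ℕ) (x : Fin n → G) (c : Fin n → ℂ), 0 ≤ (∑ i, ∑ j, (starRingEnd ℂ) (c i) * c j * ((w s ((x i)⁻¹ * x j) : ℝ) : ℂ)).re)) ∧ ∃ Λ : ℝ, ∀ s ∈ Set.Icc (0 : ℝ) 1, ∀ s' ∈ Set.Icc (0 : ℝ) 1, ∀ g : G, |Real.log (w s g) - Real.log (w s' g)| ≤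 Λ * |s - s'|; ∀ r : Literature.MathematicalPhysics.QuantumFieldTheory.LatticeRep G, ∃ E : Set ℝ, (∀ b : ℝ, (E ∩ Set.Icc 0 b).Finite) ∧ ∀ b : ℝ, 0 < b → ∃ βa ∈ Set.Ioo (0 : ℝ) b, ∀ β : ℝ, 0 < β → β ∉ E → ∃ w : ℝ → G → ℝ, Adm w ∧ (∀ s ∈ Set.Icc (0 : ℝ) 1, AnP (w s)) ∧ w 0 = (fun g => Real.exp (βa * (r.ρ g).trace.re)) ∧ w 1 = (fun g => Real.exp (β * (r.ρ g).trace.re)) := by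
  intro hA hB G i1 i2 i3 i4 hG Pseq AnP Adm r
  obtain ⟨E, hE, hreg⟩ := hA G hG r
  have hbyp := hB G hG r
  -- the chaining lemma for R a b := "Wilson(a) is joined to Wilson(b)"
  have key : ∀ a b : ℝ, 0 < a → a ≤ b → a ∉ E → b ∉ E →
      ∃ w : ℝ → G → ℝ, Adm w ∧ (∀ s ∈ Set.Icc (0 : ℝ) 1, AnP (w s)) ∧
        w 0 = (fun g => Real.exp (a * (r.ρ g).trace.re)) ∧
        w 1 = (fun g => Real.exp (b * (r.ρ g).trace.re)) := by
    refine Summit.QuantumFields.YangMills.Theorems.chain_of_localBypass hE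
      (fun a b => ∃ w : ℝ → G → ℝ, Adm w ∧ (∀ s ∈ Set.Icc (0 : ℝ) 1, AnP (w s)) ∧
        w 0 = (fun g => Real.exp (a * (r.ρ g).trace.re)) ∧
        w 1 = (fun g => Real.exp (b * (r.ρ g).trace.re))) ?_ ?_ ?_
    · -- transitivity: concatenation of admissible analytic paths
      intro a b c hab hbc
      obtain ⟨w₁, hAdm₁, hAn₁, h₁0, h₁1⟩ := hab
      obtain ⟨w₂, hAdm₂, hAn₂, h₂0, h₂1⟩ := hbc
      obtain ⟨w, hP, hL, h0, h1⟩ := Summit.QuantumFields.YangMills.Theorems.reach_trans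
        (fun v : G → ℝ => (Continuous v ∧ (∀ g : G, 0 < v g) ∧ (∀ g h : G, v (h * g * h⁻¹) = v g) ∧ (∀ g : G, v g⁻¹ = v g) ∧ (∀ (n : ℕ) (x : Fin n → G) (c : Fin n → ℂ), 0 ≤ (∑ i, ∑ j, (starRingEnd ℂ) (c i) * c j * ((v ((x i)⁻¹ * x j) : ℝ) : ℂ)).re)) ∧ AnP v)
        ⟨w₁, fun s hs => ⟨hAdm₁.1 s hs, hAn₁ s hs⟩, hAdm₁.2, h₁0, h₁1⟩
        ⟨w₂, fun s hs => ⟨hAdm₂.1 s hs, hAn₂ s hs⟩, hAdm₂.2, h₂0, h₂1⟩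
      exact ⟨w, And.intro (fun s hs => (hP s hs).1) hL, fun s hs => (hP s hs).2, h0, h1⟩
    · -- `E`-free segments: the Wilson segment, admissible and regular at every parameter
      intro a b ha hab hfree
      refine ⟨fun s g => Real.exp (((1 - s) * a + s * b) * (r.ρ g).trace.re),
        stub_wilsonSegmentAdm stub_expPosSemidef G hG r a b ha.le (ha.le.trans hab), ?_, ?_, ?_⟩
      · intro s hs
        obtain ⟨hs0, hs1⟩ := hs
        have hlo : a ≤ (1 - s) * a + s * b := by nlinarith
        have hhi : (1 - s) * a + s * b ≤ b := by nlinarith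
        exact hreg _ (lt_of_lt_of_le ha hlo) (hfree _ ⟨hlo, hhi⟩)
      · funext g
        norm_num
      · funext g
        norm_num
    · -- local bypasses from B, regularity of the two endpoints from A
      intro c hc
      obtain ⟨δ, hδ, hB'⟩ := hbyp c hc
      exact ⟨δ, hδ, fun m hm p hp hm0 hmE hpE =>
        hB' m hm p hp hm0 (hreg m hm0 hmE) (hreg p (hc.trans hp.1) hpE)⟩
  -- anchor `βa ∈ (0, b) ∖ E`, then chain upward or reverse a downward chain
  refine ⟨E, hE, fun b hb => ?_⟩
  have hInf : (Set.Ioo 0 b \ (E ∩ Set.Icc 0 b)).Infinite := (Set.Ioo_infinite hb).sdiff (hE b)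
  obtain ⟨βa, ⟨hβa0, hβab⟩, hβaE'⟩ := hInf.nonempty
  have hβaE : βa ∉ E := fun h => hβaE' ⟨h, hβa0.le, hβab.le⟩
  refine ⟨βa, ⟨hβa0, hβab⟩, fun β hβ hβE => ?_⟩
  rcases le_total βa β with hle | hle
  · exact key βa β hβa0 hle hβaE hβE
  · obtain ⟨w, hAdm, hAn, h0, h1⟩ := key β βa hβ hle hβE hβaE
    obtain ⟨w', hP, hL, h0', h1'⟩ := Summit.QuantumFields.YangMills.Theorems.reach_symm
      (fun v : G → ℝ => (Continuous v ∧ (∀ g : G, 0 < v g) ∧ (∀ g h : G, v (h * g * h⁻¹) = v g) ∧ (∀ g : G, v g⁻¹ = v g) ∧ (∀ (n : ℕ) (x : Fin n → G) (c : Fin n → ℂ), 0 ≤ (∑ i, ∑ j, (starRingEnd ℂ) (c i) * c j * ((v ((x i)⁻¹ * x j) : ℝ) : ℂ)).re)) ∧ AnP v)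
      ⟨w, fun s hs => ⟨hAdm.1 s hs, hAn s hs⟩, hAdm.2, h0, h1⟩
    exact ⟨w', And.intro (fun s hs => (hP s hs).1) hL, fun s hs => (hP s hs).2, h0', h1'⟩

/-- **`stub_anchoredDetour` — the open core of cycles 1–2, now a THEOREM of the two cycle-3 stubs** (statement verbatim as registered before the reshape; kept under its name so that the landed reduction / exactness files and `AnalyticDetour_of` below apply unchanged). -/
theorem stub_anchoredDetour :
    ∀ (G : Type) [Group G] [TopologicalSpace G] [IsTopologicalGroup G] [CompactSpace G], Literature.MathematicalPhysics.QuantumFieldTheory.IsCompactSimpleLieGroup G → letI : MeasurableSpace G := borel G; haveI : BorelSpace G := ⟨rfl⟩; let Pseq : (G → ℝ) → ℕ → ℝ := fun v L => (((L + 1 : ℕ) : ℝ) ^ 4)⁻¹ * Real.log (((MeasureTheory.Measure.pi fun _ : Literature.MathematicalPhysics.QuantumFieldTheory.Edge 4 (L + 1) => Literature.MathematicalPhysics.QuantumFieldTheory.haarProbability G).withDensity (fun U : Literature.MathematicalPhysics.QuantumFieldTheory.GaugeConfig 4 (L + 1) G => ENNReal.ofReal (Literature.MathematicalPhysics.QuantumLattice.groupHeatKernelWeight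 (fun _ : ℝ => v) 0 U))) Set.univ).toReal; let AnP : (G → ℝ) → Prop := fun v => ∀ φ : G → ℝ, Continuous φ → (∀ g h : G, φ (h * g * h⁻¹) = φ g) → ∃ p : ℝ → ℝ, (∀ t : ℝ, Filter.Tendsto (fun L : ℕ => Pseq (fun g => v g * Real.exp (t * φ g)) L) Filter.atTop (nhds (p t))) ∧ AnalyticAt ℝ p 0; let Adm : (ℝ → G → ℝ) → Prop := fun w => (∀ s ∈ Set.Icc (0 : ℝ) 1, Continuous (w s) ∧ (∀ g : G, 0 < w s g) ∧ (∀ g h : G, w s (h * g * h⁻¹) = w s g) ∧ (∀ g : G, w s g⁻¹ = w s g) ∧ (∀ (n : ℕ) (x : Fin n → G) (c : Fin n → ℂ), 0 ≤ (∑ i, ∑ j, (starRingEnd ℂ) (c i) * c j * ((w s ((x i)⁻¹ * x j) : ℝ) : ℂ)).re)) ∧ ∃ Λ : ℝ, ∀ s ∈ Set.Icc (0 : ℝ) 1, ∀ s' ∈ Set.Icc (0 : ℝ) 1, ∀ g : G, |Real.log (w s g) - Real.log (w s' g)| ≤ Λ * |s - s'|; ∀ r : Literature.MathematicalPhysics.QuantumFieldTheory.LatticeRep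 G, ∃ E : Set ℝ, (∀ b : ℝ, (E ∩ Set.Icc 0 b).Finite) ∧ ∀ b : ℝ, 0 < b → ∃ βa ∈ Set.Ioo (0 : ℝ) b, ∀ β : ℝ, 0 < β → β ∉ E → ∃ w : ℝ → G → ℝ, Adm w ∧ (∀ s ∈ Set.Icc (0 : ℝ) 1, AnP (w s)) ∧ w 0 = (fun g => Real.exp (βa * (r.ρ g).trace.re)) ∧ w 1 = (fun g => Real.exp (β * (r.ρ g).trace.re)) :=
  anchoredDetour_of_bypass stub_axisRegularOffLocallyFinite stub_localBypass

/-! ## § Assembly — sorry-free; concludes the route decl BY NAME -/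

/-- **Composition (real proof).**  The window stub's statement and the anchored-detour stub's
statement imply the crux `AnalyticDetour` BY NAME: `β₁` from the window; `E` and an anchor
`βa ∈ (0, β₁)` from the detour (`b := β₁`); for `β > 0`, `β ∉ E`, `βs ∈ (0, β₁)` the witness is the
concatenation of the window path `βs ⇝ βa` with the detour `βa ⇝ β` — admissible (`concat_forall`
for the five pointwise conditions, `concat_log_lipschitz` with constant `2(|Λ₁|+|Λ₂|)` for the
Lipschitz clause, junction `w₁ 1 = exp(βa Re tr r) = w₂ 0`), analytic at every parameter
(`concat_forall` for `AnP`), with the right endpoints (`concat_zero`, `concat_one`). -/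
theorem AnalyticDetour_of :
    (∀ (G : Type) [Group G] [TopologicalSpace G] [IsTopologicalGroup G] [CompactSpace G],
        Literature.MathematicalPhysics.QuantumFieldTheory.IsCompactSimpleLieGroup G → letI : MeasurableSpace G := borel G; haveI : BorelSpace G := ⟨rfl⟩;
        let Pseq : (G → ℝ) → ℕ → ℝ := fun v L => (((L + 1 : ℕ) : ℝ) ^ 4)⁻¹ * Real.log (((MeasureTheory.Measure.pi fun _ : Literature.MathematicalPhysics.QuantumFieldTheory.Edge 4 (L + 1) => Literature.MathematicalPhysics.QuantumFieldTheory.haarProbability G).withDensity (fun U : Literature.MathematicalPhysics.QuantumFieldTheory.GaugeConfig 4 (L + 1) G => ENNReal.ofReal (Literature.MathematicalPhysics.QuantumLattice.groupHeatKernelWeight (fun _ : ℝ => v) 0 U))) Set.univ).toReal;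
        let AnP : (G → ℝ) → Prop := fun v => ∀ φ : G → ℝ, Continuous φ → (∀ g h : G, φ (h * g * h⁻¹) = φ g) → ∃ p : ℝ → ℝ, (∀ t : ℝ, Filter.Tendsto (fun L : ℕ => Pseq (fun g => v g * Real.exp (t * φ g)) L) Filter.atTop (nhds (p t))) ∧ AnalyticAt ℝ p 0;
        let Adm : (ℝ → G → ℝ) → Prop := fun w => (∀ s ∈ Set.Icc (0 : ℝ) 1, Continuous (w s) ∧ (∀ g : G, 0 < w s g) ∧ (∀ g h : G, w s (h * g * h⁻¹) = w s g) ∧ (∀ g : G, w s g⁻¹ = w s g) ∧ (∀ (n : ℕ) (x : Fin n → G) (c : Fin n → ℂ), 0 ≤ (∑ i, ∑ j, (starRingEnd ℂ) (c i) * c j * ((w s ((x i)⁻¹ * x j) : ℝ) : ℂ)).re)) ∧ ∃ Λ : ℝ, ∀ s ∈ Set.Icc (0 : ℝ) 1, ∀ s' ∈ Set.Icc (0 : ℝ) 1, ∀ g : G, |Real.log (w s g) - Real.log (w s' g)| ≤ Λ * |s - s'|;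
        ∀ r : Literature.MathematicalPhysics.QuantumFieldTheory.LatticeRep G, ∃ β₁ : ℝ, 0 < β₁ ∧ ∀ βa ∈ Set.Ioo (0 : ℝ) β₁, ∀ βb ∈ Set.Ioo (0 : ℝ) β₁, ∃ w : ℝ → G → ℝ, Adm w ∧ (∀ s ∈ Set.Icc (0 : ℝ) 1, AnP (w s)) ∧ w 0 = (fun g => Real.exp (βa * (r.ρ g).trace.re)) ∧ w 1 = (fun g => Real.exp (βb * (r.ρ g).trace.re))) →
    (∀ (G : Type) [Group G] [TopologicalSpace G] [IsTopologicalGroup G] [CompactSpace G],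
        Literature.MathematicalPhysics.QuantumFieldTheory.IsCompactSimpleLieGroup G → letI : MeasurableSpace G := borel G; haveI : BorelSpace G := ⟨rfl⟩;
        let Pseq : (G → ℝ) → ℕ → ℝ := fun v L => (((L + 1 : ℕ) : ℝ) ^ 4)⁻¹ * Real.log (((MeasureTheory.Measure.pi fun _ : Literature.MathematicalPhysics.QuantumFieldTheory.Edge 4 (L + 1) => Literature.MathematicalPhysics.QuantumFieldTheory.haarProbability G).withDensity (fun U : Literature.MathematicalPhysics.QuantumFieldTheory.GaugeConfig 4 (L + 1) G => ENNReal.ofReal (Literature.MathematicalPhysics.QuantumLattice.groupHeatKernelWeight (fun _ : ℝ => v) 0 U))) Set.univ).toReal;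
        let AnP : (G → ℝ) → Prop := fun v => ∀ φ : G → ℝ, Continuous φ → (∀ g h : G, φ (h * g * h⁻¹) = φ g) → ∃ p : ℝ → ℝ, (∀ t : ℝ, Filter.Tendsto (fun L : ℕ => Pseq (fun g => v g * Real.exp (t * φ g)) L) Filter.atTop (nhds (p t))) ∧ AnalyticAt ℝ p 0;
        let Adm : (ℝ → G → ℝ) → Prop := fun w => (∀ s ∈ Set.Icc (0 : ℝ) 1, Continuous (w s) ∧ (∀ g : G, 0 < w s g) ∧ (∀ g h : G, w s (h * g * h⁻¹) = w s g) ∧ (∀ g : G, w s g⁻¹ = w s g) ∧ (∀ (n : ℕ) (x : Fin n → G) (c : Fin n → ℂ), 0 ≤ (∑ i, ∑ j, (starRingEnd ℂ) (c i) * c j * ((w s ((x i)⁻¹ * x j) : ℝ) : ℂ)).re)) ∧ ∃ Λ : ℝ, ∀ s ∈ Set.Icc (0 : ℝ) 1, ∀ s' ∈ Set.Icc (0 : ℝ) 1, ∀ g : G, |Real.log (w s g) - Real.log (w s' g)| ≤ Λ * |s - s'|;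
        ∀ r : Literature.MathematicalPhysics.QuantumFieldTheory.LatticeRep G, ∃ E : Set ℝ, (∀ b : ℝ, (E ∩ Set.Icc 0 b).Finite) ∧ ∀ b : ℝ, 0 < b → ∃ βa ∈ Set.Ioo (0 : ℝ) b, ∀ β : ℝ, 0 < β → β ∉ E → ∃ w : ℝ → G → ℝ, Adm w ∧ (∀ s ∈ Set.Icc (0 : ℝ) 1, AnP (w s)) ∧ w 0 = (fun g => Real.exp (βa * (r.ρ g).trace.re)) ∧ w 1 = (fun g => Real.exp (β * (r.ρ g).trace.re))) →
    AnalyticDetour := by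
  intro h1 h2 G i1 i2 i3 i4 hG Pseq AnP Adm r
  obtain ⟨β₁, hβ₁, hwin⟩ := h1 G hG r
  obtain ⟨E, hE, hanch⟩ := h2 G hG r
  obtain ⟨βa, hβa, hdet⟩ := hanch β₁ hβ₁
  refine ⟨E, hE, β₁, hβ₁, fun β hβ hβE βs hβs => ?_⟩
  obtain ⟨w₁, hAdm₁, hAn₁, hw₁0, hw₁1⟩ := hwin βs hβs βa hβa
  obtain ⟨w₂, hAdm₂, hAn₂, hw₂0, hw₂1⟩ := hdet β hβ hβE
  have hjoin : w₁ 1 = w₂ 0 := hw₁1.trans hw₂0.symm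
  obtain ⟨Λ₁, hL₁⟩ := hAdm₁.2
  obtain ⟨Λ₂, hL₂⟩ := hAdm₂.2
  refine ⟨concat w₁ w₂, ?_, concat_forall AnP hAn₁ hAn₂, ?_, ?_⟩
  · -- `Adm (concat w₁ w₂)`: the five pointwise conditions transfer branchwise; the log-Lipschitz
    -- clause holds with constant `2 (|Λ₁| + |Λ₂|)` (junction through `w₁ 1 = w₂ 0`).
    exact And.intro
      (concat_forall (fun v : G → ℝ => Continuous v ∧ (∀ g : G, 0 < v g) ∧
          (∀ g h : G, v (h * g * h⁻¹) = v g) ∧ (∀ g : G, v g⁻¹ = v g) ∧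
          (∀ (n : ℕ) (x : Fin n → G) (c : Fin n → ℂ),
            0 ≤ (∑ i, ∑ j, (starRingEnd ℂ) (c i) * c j * ((v ((x i)⁻¹ * x j) : ℝ) : ℂ)).re))
        hAdm₁.1 hAdm₂.1)
      ⟨2 * (|Λ₁| + |Λ₂|), concat_log_lipschitz hL₁ hL₂ hjoin⟩
  · rw [concat_zero]; exact hw₁0
  · rw [concat_one]; exact hw₂1

/-- The reshaped skeleton: the crux BY NAME modulo exactly the registered open stubs. -/
theorem AnalyticDetour_skeleton : AnalyticDetour :=
  AnalyticDetour_of strongCouplingWindow stub_anchoredDetour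

end Summit.QuantumFields.YangMills.Cruxes.AnalyticDetour.Birth

end
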